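import Literature.Analysis.FluidPDE.StatisticalSolution
import HarnessLib

/-!
# Stub `stub_mirrorSlabClosed` (S2) of line `registered`, crux `PumpedMirror.MirrorFloorTG`
# (stmt-AnomalousDissipation-15372)

THE A.E. MIRROR CLASS `Fix K` IS CLOSED IN `H`. On the energy space `H = Torus.energySpace (Fin 3)`
(solenoidal mean-zero `L²` vector fields on `T³`, with the `L²` topology) the class of almost
everywhere mirror-symmetric states
`Fix K = {u ∈ H | ∀ i j, (u ∘ σ_i)_j = (R_i u)_j a.e.}`, `σ_i x = (…, −x_i, …)`,
`R_i v = (…, −v_i, …)`, is closed.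

Proof (sequential): `Fix K = ⋂_{i,j} A_{ij}` and each `A_{ij}` is sequentially closed. If `uₙ → u`
in `H` then `uₙ → u` in `L²`, hence in measure, so a subsequence converges almost everywhere
(`TendstoInMeasure.exists_seq_tendsto_ae`). The coordinate reflection `σ_i` preserves the Haar
probability measure of `T³ = (ℝ/ℤ)³` (product of `−id` on one `UnitAddCircle` factor with the
identity on the others, `MeasureTheory.volume_preserving_pi`; the same computation is in tree as
`MirrorStatisticsLoudTG.Negative.measurePreserving_reflect`, whose refuter-side module is deliberately
not imported here), so the subsequence also converges almost everywhere along `σ_i`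
(`QuasiMeasurePreserving.ae`), and the pointwise identities `uₙ(σ_i x)_j = ±uₙ(x)_j` pass to the
limit by uniqueness of limits in `ℝ`.

References: Kida 1985 (high-symmetric flows), §2; Foias–Manley–Rosa–Temam 2001, Ch. IV §1.1
(closed constraint sets in `H`). The measure theory is Mathlib's.
-/

-- every `Summit.AnomalousDissipation.AnomalousDissipation.…` name repeats the summit = problem segment (D-0017 layout)
set_option linter.dupNamespace false

noncomputable section

namespace Summit.AnomalousDissipation.AnomalousDissipation.Theorems.PumpedMirrorMirrorFloorTG

open MeasureTheory Filter Topology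
open Literature.Analysis.FunctionSpaces Literature.Analysis.FluidPDE

/-- **S2 `stub_mirrorSlabClosed`** — the a.e. mirror class `Fix K ⊆ H` is closed in the energy
space: each of the nine conditions `(u ∘ σ_i)_j = (R_i u)_j` a.e. defines a sequentially closed
set, because an `L²`-convergent sequence has an a.e.-convergent subsequence, which also converges
a.e. along the measure-preserving reflection `σ_i`, and the pointwise identities pass to the limit.
[folklore] -/
theorem stub_mirrorSlabClosed :
    IsClosed {u : Torus.energySpace (Fin 3) | ∀ i j : Fin 3,
      (fun x => (u.1 : UnitAddTorus (Fin 3) → EuclideanSpace ℝ (Fin 3)) (Function.update x i (-x i)) j)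
        =ᵐ[volume]
      (fun x => if j = i then -((u.1 : UnitAddTorus (Fin 3) → EuclideanSpace ℝ (Fin 3)) x j)
        else (u.1 : UnitAddTorus (Fin 3) → EuclideanSpace ℝ (Fin 3)) x j)} := by
  simp only [Set.setOf_forall]
  refine isClosed_iInter fun i => isClosed_iInter fun j => IsSeqClosed.isClosed ?_
  -- the reflection `σ_i` preserves the Haar measure of `T³` (product of `−id` and identities)
  have hσ : MeasurePreserving (fun x : UnitAddTorus (Fin 3) => Function.update x i (-x i))
      volume volume := by
    have h := volume_preserving_pi (α' := fun _ : Fin 3 => UnitAddCircle)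
      (β' := fun _ : Fin 3 => UnitAddCircle)
      (f := fun k => if k = i then (Neg.neg : UnitAddCircle → UnitAddCircle) else id) (fun k => by
        split_ifs
        · exact Measure.measurePreserving_neg _
        · exact MeasurePreserving.id _)
    have heq : (fun (x : UnitAddTorus (Fin 3)) (k : Fin 3) =>
        (if k = i then (Neg.neg : UnitAddCircle → UnitAddCircle) else id) (x k)) =
        fun x => Function.update x i (-x i) := by
      funext x k
      by_cases hk : k = i
      · subst hk
        simp
      · simp [hk]
    rwa [heq] at h
  intro U u hU hUu
  simp only [Set.mem_setOf_eq] at hU ⊢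
  -- `U n → u` in `H`, hence in `L²`, hence a subsequence converges almost everywhere
  have h1 : Tendsto (fun n => ((U n).1 : Lp (EuclideanSpace ℝ (Fin 3)) 2
      (volume : Measure (UnitAddTorus (Fin 3))))) atTop (𝓝 u.1) :=
    (continuous_subtype_val.tendsto u).comp hUu
  obtain ⟨ns, -, hae⟩ := (tendstoInMeasure_of_tendsto_Lp h1).exists_seq_tendsto_ae
  -- … and also almost everywhere along the measure-preserving reflection `σ_i`
  have hae' : ∀ᵐ x ∂(volume : Measure (UnitAddTorus (Fin 3))),
      Tendsto (fun k => ((U (ns k)).1 : UnitAddTorus (Fin 3) → EuclideanSpace ℝ (Fin 3))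
        (Function.update x i (-x i))) atTop
        (𝓝 ((u.1 : UnitAddTorus (Fin 3) → EuclideanSpace ℝ (Fin 3))
          (Function.update x i (-x i)))) :=
    hσ.quasiMeasurePreserving.ae hae
  have hmem : ∀ᵐ x ∂(volume : Measure (UnitAddTorus (Fin 3))), ∀ k,
      ((U (ns k)).1 : UnitAddTorus (Fin 3) → EuclideanSpace ℝ (Fin 3))
          (Function.update x i (-x i)) j =
        if j = i then -(((U (ns k)).1 : UnitAddTorus (Fin 3) → EuclideanSpace ℝ (Fin 3)) x j)
        else ((U (ns k)).1 : UnitAddTorus (Fin 3) → EuclideanSpace ℝ (Fin 3)) x j :=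
    ae_all_iff.2 fun k => hU (ns k)
  have hproj : Continuous fun v : EuclideanSpace ℝ (Fin 3) => v j := (EuclideanSpace.proj j).continuous
  filter_upwards [hae, hae', hmem] with x hx hx' hxm
  -- pass to the limit in the pointwise identities along the subsequence
  have h2 : Tendsto (fun k =>
      if j = i then -(((U (ns k)).1 : UnitAddTorus (Fin 3) → EuclideanSpace ℝ (Fin 3)) x j)
      else ((U (ns k)).1 : UnitAddTorus (Fin 3) → EuclideanSpace ℝ (Fin 3)) x j) atTop
      (𝓝 (if j = i then -((u.1 : UnitAddTorus (Fin 3) → EuclideanSpace ℝ (Fin 3)) x j)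
        else (u.1 : UnitAddTorus (Fin 3) → EuclideanSpace ℝ (Fin 3)) x j)) := by
    split_ifs
    · exact ((hproj.tendsto _).comp hx).neg
    · exact (hproj.tendsto _).comp hx
  exact tendsto_nhds_unique ((hproj.tendsto _).comp hx') (h2.congr fun k => (hxm k).symm)

end Summit.AnomalousDissipation.AnomalousDissipation.Theorems.PumpedMirrorMirrorFloorTG

end
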